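import Literature.NumberTheory.EllipticCurves.KramerTunnell1982.FiniteFieldQuadraticLangProofs
import HarnessLib

/-!
# Lang's theorem in the quadratic layer for `𝔾_a` and `𝔾_m`: `Ĥ⁰ = H¹ = 0` for `Gal(k'/k)` on
`(k', +)` and `k'ˣ` (cuspidal and nodal reduction)

K. Kramer, J. Tunnell, *Elliptic curves and local ε-factors*, Compositio Math. **46** (1982), §6
(p. 327): "It follows from Lang's theorem [9] that `N : E⁰(K) → E⁰(F)` is surjective."  At a
place of bad reduction the connected component of the special fibre is `𝔾_a` (additive
reduction: Kodaira types `II, III, IV, I₀*, I_v*, IV*, III*, II*`; `Ẽ_ns(k') ≅ (k', +)`, Silverman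
*AEC* III.2.5, the tree's `SingularCubic.cuspHom`) or a one-dimensional torus (multiplicative
reduction `I_v`: `Ẽ_ns(k') ≅ k'ˣ`, `SingularCubic.nodeEquiv`, with `Gal(k'/k)` acting through
`u ↦ τu` for a split node and `u ↦ (τu)⁻¹` for a non-split one).  Lang's theorem for these
groups over the finite field `k` amounts to the four elementary statements proved here, for a
field `k'` with a non-trivial involutive automorphism `τ` (finiteness is used only through the
Herbrand count of `FiniteFieldQuadraticLangProofs`):

* `exists_add_algEquiv_eq` — **`Ĥ⁰(k'⁺) = 0`**: every `τ`-fixed `a` is `b + τ b` (trace onto);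
* `exists_algEquiv_sub_eq` — **`H¹(k'⁺) = 0`** (additive Hilbert 90): `a + τ a = 0 ⇒ a = τ b - b`;
* `exists_algEquiv_div_eq` — **`H¹(k'ˣ) = 0`** (Hilbert 90): `a · τ a = 1 ⇒ a = τ b / b`;
* `exists_mul_algEquiv_eq` — **`Ĥ⁰(k'ˣ) = 0`** (the norm is onto): every non-zero `τ`-fixed `a`
  is `b · τ b`.

(For the twisted action `u ↦ (τu)⁻¹` the rôles of the last two are exchanged.)  Theorems only; no
definition, no named fact, no `sorry` (D-0026: net debt `0`).

## References

* [KramerTunnell1982] K. Kramer, J. Tunnell, Compositio Math. 46 (1982), §6 p. 327.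
* [Lang1956] S. Lang, *Algebraic groups over finite fields*, Amer. J. Math. 78 (1956), Thm. 2
  (`H¹(k, G) = 0` for a connected algebraic group over a finite field).
* [SerreLocalFields1979] J.-P. Serre, *Local Fields*, Ch. X §1 Prop. 1 (additive form) and
  Prop. 2 (Hilbert's Theorem 90); Ch. VIII §4 Prop. 8 (Herbrand quotient of a finite module).
-/

namespace Literature.NumberTheory.EllipticCurves.KramerTunnell1982

section GaGm

variable {k : Type*} [Field k] {k' : Type*} [Field k'] [Algebra k k']
  (τ : k' ≃ₐ[k] k') (hτ1 : τ ≠ 1)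

include hτ1 in
/-- For a non-trivial automorphism `τ` of a field, `b + τ b ≠ 0` for some `b` (otherwise
`τ = -1` would be multiplicative, forcing `2 = 0` and then `τ = 1`). [folklore] -/
private theorem exists_add_algEquiv_ne_zero : ∃ b : k', b + τ b ≠ 0 := by
  by_contra h
  push Not at h
  have hneg : ∀ b : k', τ b = -b := fun b => eq_neg_of_add_eq_zero_right (h b)
  have h2 : (2 : k') = 0 := by
    have h1 := hneg 1
    rw [map_one] at h1
    linear_combination h1
  apply hτ1
  ext b
  rw [AlgEquiv.one_apply, hneg]
  have : (2 : k') * b = 0 := by rw [h2, zero_mul]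
  calc -b = b - 2 * b := by ring
    _ = b := by rw [this, sub_zero]

include hτ1 in
/-- **`Ĥ⁰(⟨τ⟩, (k', +)) = 0` — the trace of a quadratic extension is onto**: for a non-trivial
involutive automorphism `τ` of the field `k'`, every `τ`-fixed `a ∈ k'` is `b + τ b`
(`b = a c₀⁻¹ b₀` for any `c₀ = b₀ + τ b₀ ≠ 0`).  This is Lang's theorem for `𝔾_a`
(`N : E⁰(K) → E⁰(F)` onto at an additive place, Kramer–Tunnell p. 327) in the residue extension.
[cite: KramerTunnell1982, §6 p. 327 ("It follows from Lang's theorem [9] …")] -/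
theorem exists_add_algEquiv_eq (hττ : ∀ x, τ (τ x) = x) {a : k'} (ha : τ a = a) :
    ∃ b : k', b + τ b = a := by
  obtain ⟨b₀, hb₀⟩ := exists_add_algEquiv_ne_zero τ hτ1
  have hc₀ : τ (b₀ + τ b₀) = b₀ + τ b₀ := by rw [map_add, hττ, add_comm]
  refine ⟨a * (b₀ + τ b₀)⁻¹ * b₀, ?_⟩
  rw [map_mul, map_mul, map_inv₀, ha, hc₀, ← mul_add, mul_assoc, inv_mul_cancel₀ hb₀, mul_one]

include hτ1 in
/-- **`H¹(⟨τ⟩, (k', +)) = 0` — additive Hilbert 90 in the quadratic layer**: for a finite field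
`k'` with a non-trivial involutive automorphism `τ`, every `a` with `a + τ a = 0` is `τ b - b`
(from `Ĥ⁰ = 0` by the Herbrand count `AddMonoidHom.exists_sub_eq_of_forall_exists_add_eq`).
Lang's theorem for `𝔾_a` over a finite field (`H¹ = 0` for a connected group); Serre,
*Local Fields*, X §1 Prop. 1. [cite: SerreLocalFields1979, Ch. X §1 Prop. 1 (additive Hilbert 90)] -/
theorem exists_algEquiv_sub_eq [Finite k'] (hττ : ∀ x, τ (τ x) = x) {a : k'}
    (ha : a + τ a = 0) : ∃ b : k', τ b - b = a := by
  have h := AddMonoidHom.exists_sub_eq_of_forall_exists_add_eq (τ : k' →+ k')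
    (fun x => by simpa using hττ x)
    (fun m hm => by
      obtain ⟨n, hn⟩ := exists_add_algEquiv_eq τ hτ1 hττ (a := m) (by simpa using hm)
      exact ⟨n, by simpa using hn⟩)
    (m := a) (by simpa using ha)
  simpa using h


/-! ## §2 The multiplicative group (nodal reduction): Hilbert 90 and the norm -/

include hτ1 in
/-- **Hilbert's Theorem 90 in the quadratic layer**: for a non-trivial involutive automorphism
`τ` of the field `k'`, every `a` with `a · τ a = 1` is `τ b / b` with `b ≠ 0` (take
`b = τ(θ + a τθ)` for any `θ` with `θ + a τθ ≠ 0`; if no such `θ` existed then `a = -1` and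
`τ = 1`).  This is `H¹ = 0` for `Gal(k'/k)` on `𝔾_m(k')` — Lang's theorem for the torus at a
place of (split) multiplicative reduction, and `Ĥ⁰ = 0` for the norm-one torus (non-split node).
Serre, *Local Fields*, Ch. X §1 Prop. 2 (Hilbert 90). [cite: SerreLocalFields1979, Ch. X §1 Prop. 2 (Hilbert's Theorem 90)] -/
theorem exists_algEquiv_div_eq (hττ : ∀ x, τ (τ x) = x) {a : k'} (ha : a * τ a = 1) :
    ∃ b : k', b ≠ 0 ∧ τ b / b = a := by
  -- some `θ` with `θ + a τθ ≠ 0`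
  obtain ⟨θ, hθ⟩ : ∃ θ : k', θ + a * τ θ ≠ 0 := by
    by_contra h
    push Not at h
    have h1 : (1 : k') + a = 0 := by simpa using h 1
    have ha1 : a = -1 := by linear_combination h1
    apply hτ1
    ext x
    rw [AlgEquiv.one_apply]
    have hx := h x
    rw [ha1, neg_one_mul, add_neg_eq_zero] at hx
    exact hx.symm
  have ha0 : a ≠ 0 := fun h0 => by rw [h0, zero_mul] at ha; exact zero_ne_one ha
  -- `c = θ + a τθ` satisfies `a τc = c`; put `b = τ c`
  have hc : a * τ (θ + a * τ θ) = θ + a * τ θ := by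
    rw [map_add, map_mul, hττ, mul_add, ← mul_assoc, ha, one_mul, add_comm]
  refine ⟨τ (θ + a * τ θ), fun h0 => hθ ?_, ?_⟩
  · rw [← hc, h0, mul_zero]
  · rw [hττ, eq_comm, eq_div_iff (fun h0 => hθ (by rw [← hc, h0, mul_zero]))]
    exact hc

include hτ1 in
/-- **The norm of a quadratic extension of finite fields is onto** (`Ĥ⁰ = 0` for `Gal(k'/k)` on
`𝔾_m(k')`, equivalently — for the twisted action `u ↦ (τu)⁻¹` — `H¹ = 0` for the norm-one torus
of a non-split node): for a finite field `k'` with a non-trivial involutive automorphism `τ`, every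
non-zero `τ`-fixed `a` is a norm `b · τ b`.  From Hilbert 90 by the Herbrand count for the finite
module `k'ˣ` (`AddMonoidHom.exists_add_eq_of_forall_exists_sub_eq`).  Lang's theorem for tori
over finite fields. [cite: KramerTunnell1982, §6 p. 327 ("It follows from Lang's theorem [9] …")] -/
theorem exists_mul_algEquiv_eq [Finite k'] (hττ : ∀ x, τ (τ x) = x) {a : k'} (ha : τ a = a)
    (ha0 : a ≠ 0) : ∃ b : k', b * τ b = a := by
  -- the involution of the finite module `Additive k'ˣ`
  set σ : Additive k'ˣ →+ Additive k'ˣ :=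
    MonoidHom.toAdditive (Units.map (τ : k' ≃ₐ[k] k').toMonoidHom) with hσ
  have hσ_apply : ∀ m : Additive k'ˣ,
      ((Additive.toMul (σ m) : k'ˣ) : k') = τ ((Additive.toMul m : k'ˣ) : k') := fun m => rfl
  have hσσ : ∀ m, σ (σ m) = m := fun m => by
    apply Additive.toMul.injective
    ext
    change τ (τ ((Additive.toMul m : k'ˣ) : k')) = _
    exact hττ _
  -- Hilbert 90 gives `H¹ = 0` on `k'ˣ`
  have h1 : ∀ m : Additive k'ˣ, m + σ m = 0 → ∃ n, σ n - n = m := by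
    intro m hm
    have hm' : ((Additive.toMul m : k'ˣ) : k') * τ ((Additive.toMul m : k'ˣ) : k') = 1 := by
      have h := congrArg (fun x : Additive k'ˣ => ((Additive.toMul x : k'ˣ) : k')) hm
      simpa [toMul_add, hσ_apply] using h
    obtain ⟨b, hb0, hb⟩ := exists_algEquiv_div_eq τ hτ1 hττ hm'
    refine ⟨Additive.ofMul (Units.mk0 b hb0), ?_⟩
    apply Additive.toMul.injective
    ext
    simp only [toMul_sub, toMul_ofMul, Units.val_div_eq_div_val, Units.val_mk0]
    rw [← hb]
    rfl
  obtain ⟨n, hn⟩ := AddMonoidHom.exists_add_eq_of_forall_exists_sub_eq σ hσσ h1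
    (m := Additive.ofMul (Units.mk0 a ha0)) (by
      apply Additive.toMul.injective
      ext
      change τ a = a
      exact ha)
  refine ⟨((Additive.toMul n : k'ˣ) : k'), ?_⟩
  have h := congrArg (fun x : Additive k'ˣ => ((Additive.toMul x : k'ˣ) : k')) hn
  simpa [toMul_add, hσ_apply] using h

end GaGm

end Literature.NumberTheory.EllipticCurves.KramerTunnell1982
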